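import Mathlib.Analysis.Calculus.Deriv.Inverse
import Mathlib.Analysis.Calculus.FDeriv.RestrictScalars
import Mathlib.LinearAlgebra.FiniteDimensional.Basic
import Mathlib.Analysis.Complex.Basic
import Literature.Barriers.CriticalPhenomena.EmbeddingModulusUniquenessProofs
import HarnessLib

/-!
# Sheared quadrilaterals: the Beltrami algebra of `φ_β ∘ f'` (towards `ShearCrossRatioAnalytic`)

Topic `Literature/Probability/RandomPlanarGeometry`; first of three files
(`ShearModulusAnalyticBeltrami`, `ShearModulusAnalyticDatum`, `ShearModulusAnalyticProofs`)
carrying out the reduction, sketched in the docstring of the named fact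
`Literature.Probability.RandomPlanarGeometry.ShearCrossRatioAnalytic` (`ShearModulusAnalytic.lean`),
of the real-analyticity of the conformal modulus of Beffara's sheared quad `φ_α R'` in the shear
`α` to the Ahlfors–Bers theorem on the analytic dependence of normalised solutions of the
Beltrami equation on parameters (L. V. Ahlfors, L. Bers, *Riemann's mapping theorem for variable
metrics*, Ann. of Math. 72 (1960), Thm. 11 and its Corollary p. 404). Everything here is PROVED;
no definition is introduced. This file is the pointwise linear algebra of Beltrami coefficients:

* `realCLM_apply_eq_of_beltrami` — a real-linear `A : ℂ → ℂ` is `A h = a h + b h̄` with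
  `2a = A 1 - i A i`, `2b = A 1 + i A i` (Wirtinger parts), so `A h = a (h + m h̄)` when `b = m a`;
* `realCLM_injective_of_beltrami` — `b = m a`, `|m| < 1`, `a ≠ 0` ⟹ `A` injective;
* `hasDerivAt_comp_localInverse_of_beltrami` — **Ahlfors–Bers Thm. 5 (vii) in pointwise `C¹`
  form**: if `W` and `G` have real derivatives with the SAME Beltrami coefficient at `w` and `V`
  is a continuous local inverse of `W` at `W w`, then `G ∘ V` is complex-differentiable at `W w`
  (with derivative `a_G / a_W`);
* `exists_hasFDerivAt_moduliShear_comp` — the real derivative of `φ_β ∘ f` for holomorphic `f`: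
  `2a = (1 - iβ) f′`, `2b = (1 + iβ) \overline{f′}`, i.e. Beltrami coefficient
  `ν(β) \overline{f′}/f′` with `ν(β) = (1 + iβ)/(1 - iβ)` (Beffara's `φ_β(z) = (1-iβ)/2·z + (1+iβ)/2·z̄`,
  `moduliShear_eq_hol_add_antihol`);
* `one_sub_I_mul_ne_zero`, `norm_shearBeltrami_lt_one` — `|ν(β)| < 1` for `im β > 0`.

## References

* L. V. Ahlfors, L. Bers, *Riemann's mapping theorem for variable metrics*, Ann. of Math. (2) 72
  (1960), 385–404, Thm. 5 (vii). [AhlforsBers1960]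
* V. Beffara, *Is critical 2D percolation universal?*, Progr. Probab. 60 (2008), §1.1.
  [Beffara2008Universal]
-/

noncomputable section

open Set Filter Complex
open scoped Topology ComplexConjugate

namespace Literature.Probability.RandomPlanarGeometry

open Literature.Barriers.CriticalPhenomena (moduliShear moduliShear_eq_hol_add_antihol)

/-- **Beltrami form of a real-linear self-map of `ℂ`.** A real-linear `A : ℂ → ℂ` has the
Wirtinger decomposition `A h = a h + b h̄`, `2a = A 1 - i·A i`, `2b = A 1 + i·A i`; if `b = m a`
(Beltrami relation with coefficient `m`) then `A h = a (h + m h̄)`. [folklore] -/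
theorem realCLM_apply_eq_of_beltrami {A : ℂ →L[ℝ] ℂ} {m : ℂ}
    (hA : A 1 + I * A I = m * (A 1 - I * A I)) (h : ℂ) :
    A h = (A 1 - I * A I) / 2 * (h + m * conj h) := by
  -- the Wirtinger decomposition `A h = a h + b h̄`
  have wirt : A h = (A 1 - I * A I) / 2 * h + (A 1 + I * A I) / 2 * conj h := by
    obtain ⟨x, y, rfl⟩ : ∃ x y : ℝ, h = x + y * I := ⟨h.re, h.im, (re_add_im h).symm⟩
    have h1 : A (x + y * I) = (x : ℂ) * A 1 + (y : ℂ) * A I := by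
      have e : (x : ℂ) + y * I = (x : ℝ) • (1 : ℂ) + (y : ℝ) • I := by
        rw [Complex.real_smul, Complex.real_smul, mul_one]
      rw [e, map_add, A.map_smul, A.map_smul, Complex.real_smul, Complex.real_smul]
    have hc : conj ((x : ℂ) + y * I) = (x : ℂ) - (y : ℂ) * I := by
      rw [map_add, map_mul, Complex.conj_ofReal, Complex.conj_ofReal, Complex.conj_I]; ring
    rw [h1, hc]
    linear_combination ((y : ℂ) * A I) * Complex.I_mul_I
  rw [wirt, hA]
  ring

/-- A real-linear self-map of `ℂ` whose Wirtinger parts `a = (A 1 - I·A I)/2 ≠ 0`,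
`b = (A 1 + I·A I)/2 = m a` satisfy a Beltrami relation with `‖m‖ < 1` is injective
(`A g = a (g + m ḡ)` and `|m ḡ| < |g|`). [folklore] -/
theorem realCLM_injective_of_beltrami {A : ℂ →L[ℝ] ℂ} {m : ℂ} (hm : ‖m‖ < 1)
    (ha : A 1 - I * A I ≠ 0) (hA : A 1 + I * A I = m * (A 1 - I * A I)) :
    Function.Injective A := by
  intro g g' hgg'
  rw [realCLM_apply_eq_of_beltrami hA g, realCLM_apply_eq_of_beltrami hA g'] at hgg'
  have h3 := mul_left_cancel₀ (div_ne_zero ha two_ne_zero) hgg'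
  have h4 : g - g' = -(m * conj (g - g')) := by
    rw [map_sub]
    linear_combination h3
  by_contra hne
  have h6 : 0 < ‖g - g'‖ := norm_pos_iff.2 (sub_ne_zero.2 hne)
  have h5 : ‖g - g'‖ = ‖m‖ * ‖g - g'‖ := by
    conv_lhs => rw [h4]
    rw [norm_neg, norm_mul, Complex.norm_conj]
  nlinarith

/-- **Maps with the same Beltrami coefficient differ by a conformal factor.** If `W` and `G` are
real-differentiable at `w` with real derivatives `A`, `B` satisfying the SAME Beltrami relation
(`b = m a` for the Wirtinger parts, `‖m‖ < 1`, `a_A ≠ 0`), and `V` is a continuous local inverse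
of `W` at `z = W w`, then `G ∘ V` is complex-differentiable at `z` with derivative `a_B / a_A`
(Ahlfors–Bers 1960, Thm. 5 (vii): "if `φ` is `μ`-conformal then `φ ∘ (f^μ)⁻¹` is analytic", in
its pointwise `C¹` form). [cite: AhlforsBers1960, Thm. 5 (vii)] -/
theorem hasDerivAt_comp_localInverse_of_beltrami {W G V : ℂ → ℂ} {A B : ℂ →L[ℝ] ℂ}
    {m w z : ℂ} (hW : HasFDerivAt W A w) (hG : HasFDerivAt G B w) (hm : ‖m‖ < 1)
    (ha : A 1 - I * A I ≠ 0) (hA : A 1 + I * A I = m * (A 1 - I * A I))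
    (hB : B 1 + I * B I = m * (B 1 - I * B I))
    (hz : V z = w) (hV : ContinuousAt V z) (hWV : ∀ᶠ y in 𝓝 z, W (V y) = y) :
    HasDerivAt (G ∘ V) ((B 1 - I * B I) / (A 1 - I * A I)) z := by
  have hinj := realCLM_injective_of_beltrami hm ha hA
  set Ae : ℂ ≃L[ℝ] ℂ := (LinearEquiv.ofInjectiveEndo A.toLinearMap hinj).toContinuousLinearEquiv
    with hAe
  have hAe_apply : ∀ h, Ae h = A h := fun h => rfl
  have hAe_coe : (Ae : ℂ →L[ℝ] ℂ) = A := by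
    ext1 h
    exact hAe_apply h
  have hW' : HasFDerivAt W (Ae : ℂ →L[ℝ] ℂ) (V z) := by
    rw [hAe_coe, hz]
    exact hW
  have hV' : HasFDerivAt V (Ae.symm : ℂ →L[ℝ] ℂ) z := HasFDerivAt.of_local_left_inverse hV hW' hWV
  have hGV : HasFDerivAt (G ∘ V) (B.comp (Ae.symm : ℂ →L[ℝ] ℂ)) z := by
    have hG' : HasFDerivAt G B (V z) := by
      rw [hz]
      exact hG
    exact hG'.comp z hV'
  have key : ∀ h, B (Ae.symm h) = (B 1 - I * B I) / (A 1 - I * A I) * h := by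
    intro h
    have hAg : A (Ae.symm h) = h := by
      rw [← hAe_apply]
      exact Ae.apply_symm_apply h
    conv_rhs => rw [← hAg]
    rw [realCLM_apply_eq_of_beltrami hB (Ae.symm h), realCLM_apply_eq_of_beltrami hA (Ae.symm h)]
    field_simp
  have hL : (ContinuousLinearMap.smulRight (1 : ℂ →L[ℂ] ℂ)
      ((B 1 - I * B I) / (A 1 - I * A I))).restrictScalars ℝ = B.comp (Ae.symm : ℂ →L[ℝ] ℂ) := by
    ext1 h
    rw [ContinuousLinearMap.coe_restrictScalars', ContinuousLinearMap.smulRight_apply,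
      ContinuousLinearMap.coe_comp, Function.comp_apply, ContinuousLinearEquiv.coe_coe, key,
      smul_eq_mul, mul_comm]
    rfl
  exact hasDerivAt_iff_hasFDerivAt.2 (hasFDerivAt_of_restrictScalars ℝ hGV hL)


/-- **Real derivative of `φ_β ∘ f`** for a complex-differentiable `f`: Beffara's shear
`φ_β(z) = (1 - iβ)/2 · z + (1 + iβ)/2 · z̄` is real-linear, so `D(φ_β ∘ f)(w) h = φ_β (f′(w) h)`,
with Wirtinger parts `2a = (1 - iβ) f′(w)`, `2b = (1 + iβ) \overline{f′(w)}` (Beltrami coefficient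
`(1 + iβ)/(1 - iβ) · \overline{f′}/f′`). [cite: Beffara2008Universal, §1.1] -/
theorem exists_hasFDerivAt_moduliShear_comp {f : ℂ → ℂ} {c w : ℂ} (β : ℂ)
    (hf : HasDerivAt f c w) :
    ∃ B : ℂ →L[ℝ] ℂ, HasFDerivAt (fun z => moduliShear β (f z)) B w ∧
      B 1 - I * B I = (1 - I * β) * c ∧ B 1 + I * B I = (1 + I * β) * conj c := by
  set S : ℂ →L[ℝ] ℂ := Complex.reCLM.smulRight (1 : ℂ) + Complex.imCLM.smulRight β with hS
  have hSapp : ∀ z, S z = moduliShear β z := by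
    intro z
    simp only [hS, add_apply, ContinuousLinearMap.smulRight_apply,
      Complex.reCLM_apply, Complex.imCLM_apply, Complex.real_smul, mul_one, moduliShear]
    ring
  have hSd : HasFDerivAt (moduliShear β) S (f w) := by
    have e : moduliShear β = ⇑S := funext fun z => (hSapp z).symm
    rw [e]
    exact S.hasFDerivAt
  set L : ℂ →L[ℝ] ℂ := (ContinuousLinearMap.smulRight (1 : ℂ →L[ℂ] ℂ) c).restrictScalars ℝ
    with hL
  have hf' : HasFDerivAt f L w := (hasDerivAt_iff_hasFDerivAt.1 hf).restrictScalars ℝ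
  have hLapp : ∀ h, L h = h * c := by
    intro h
    rw [hL, ContinuousLinearMap.coe_restrictScalars', ContinuousLinearMap.smulRight_apply,
      smul_eq_mul]
    rfl
  have hB : ∀ h, S.comp L h = moduliShear β (h * c) := by
    intro h
    rw [ContinuousLinearMap.coe_comp, Function.comp_apply, hLapp, hSapp]
  refine ⟨S.comp L, hSd.comp w hf', ?_, ?_⟩
  · rw [hB, hB, one_mul, moduliShear_eq_hol_add_antihol, moduliShear_eq_hol_add_antihol, map_mul,
      Complex.conj_I]
    linear_combination (-(1 - I * β) / 2 * c + (1 + I * β) / 2 * conj c) * Complex.I_mul_I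
  · rw [hB, hB, one_mul, moduliShear_eq_hol_add_antihol, moduliShear_eq_hol_add_antihol, map_mul,
      Complex.conj_I]
    linear_combination ((1 - I * β) / 2 * c - (1 + I * β) / 2 * conj c) * Complex.I_mul_I

/-- `1 - iβ ≠ 0` for `β` in the upper half-plane (its real part is `1 + im β > 0`). [folklore] -/
theorem one_sub_I_mul_ne_zero {β : ℂ} (hβ : 0 < β.im) : 1 - I * β ≠ 0 := by
  intro h
  have := congrArg Complex.re h
  simp at this
  linarith

/-- **The Beltrami coefficient `ν(β) = (1 + iβ)/(1 - iβ)` of Beffara's shear `φ_β` lies in the unit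
disc exactly when `β` is in the upper half-plane** (`|1 ∓ iβ|² = (1 ± im β)² + (re β)²`).
[cite: Beffara2008Universal, §1.1] -/
theorem norm_shearBeltrami_lt_one {β : ℂ} (hβ : 0 < β.im) : ‖(1 + I * β) / (1 - I * β)‖ < 1 := by
  rw [norm_div, div_lt_one (norm_pos_iff.2 (one_sub_I_mul_ne_zero hβ))]
  have h1 : ‖1 + I * β‖ ^ 2 = (1 - β.im) ^ 2 + β.re ^ 2 := by
    rw [Complex.sq_norm, Complex.normSq_apply]
    simp
    ring
  have h2 : ‖1 - I * β‖ ^ 2 = (1 + β.im) ^ 2 + β.re ^ 2 := by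
    rw [Complex.sq_norm, Complex.normSq_apply]
    simp
    ring
  have h3 : ‖1 + I * β‖ ^ 2 < ‖1 - I * β‖ ^ 2 := by
    rw [h1, h2]
    nlinarith
  nlinarith [norm_nonneg (1 + I * β), norm_nonneg (1 - I * β)]

end Literature.Probability.RandomPlanarGeometry
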